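import Summits.NavierStokesRegularity.NavierStokesRegularity.Theorems.PumpContinuationMildBlowupClassical
import Summits.NavierStokesRegularity.NavierStokesRegularity.Theorems.PerpetualPumpThesisFloor
import Summits.NavierStokesRegularity.NavierStokesRegularity.Theorems.PerpetualPumpThesisUniqueness
import Summits.NavierStokesRegularity.NavierStokesRegularity.Theorems.PumpContinuationBoundedTemperatureClosedSchwartzData
import Summits.NavierStokesRegularity.NavierStokesRegularity.Theorems.AdiabaticEddyClayUniquenessCore
import Summits.NavierStokesRegularity.NavierStokesRegularity.Theorems.BlowupAssembly
import Literature.Analysis.FluidPDE.FluidComputer.PumpCascade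
import Literature.Barriers.NavierStokesRegularity.AveragedTypeIBlowup
import HarnessLib

/-!
# Fluid computer blueprint — summit-side glue: a cascade witness / pump cascade for TRUE NS gives X5a and `¬ NavierStokesRegularity`

HONEST FRAMING: low prior, high value-of-information experiment on Tao's machine paradigm; NOT a
claim that NS blows up. Nothing in this file or its imports constructs a `CascadeWitness` or a
`PumpCascade`; every theorem below is an implication from such a (so far uninhabited) structure.

The Literature files `Literature/Analysis/FluidPDE/FluidComputer/{SpecArithmetic, CascadeWitness,
PumpCascade}.lean` type Tao's machine programme (J. Amer. Math. Soc. 29 (2016), §1.3) for the true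
Navier–Stokes Euler form and prove its soft assembly conditional on two named standard facts,
`FluidComputer.H10MildTheory` (local existence, uniqueness, `H¹⁰` continuation for `H¹⁰_df`-mild
solutions of `∂ₜu = Δu + B(u,u)`) and `FluidComputer.MildMaximalGivesBlowup` (verbatim
`Theses.PumpContinuation.MildBlowupClassical`). This file DISCHARGES both from theorems already in
the tree and draws the summit-side conclusions:

* `h10MildTheory_holds` — from `PerpetualPumpThesis.stub_thesis_LocalExistenceH10`,
  `PerpetualPumpThesis.stub_uniqueness`, `PerpetualPumpThesis.Floor.extends_of_H10_bounded` at the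
  Euler averaging datum (the landed `Literature.Barriers.NavierStokesRegularity.AveragedTypeI.euler_form_eq :
  euler.form = eulerForm`);
* `mildMaximalGivesBlowup_holds` — `pumpContinuation_mildBlowupClassical_proof`;
* `x5a_of_cascadeWitness'` — X5a (a finite-energy classical solution from a rapidly decaying datum
  with finite maximal time of smooth existence; the statement of the first conjunct of
  `Literature.NS.blowup_assembly`, stated here verbatim rather than through a route decl) from a
  `CascadeWitness`, and `ns_blowup_of_cascadeWitness : CascadeWitness → ¬ NavierStokesRegularity`
  (via `Literature.NS.blowup_assembly` + `blowup_clay_uniqueness`);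
* the same two conclusions from a `PumpCascade S` with `0 < S.alpha`, `1/4 < S.eta`, and the
  `H¹⁰`-norm blow-up by time `T_* = ∑ C λ_n^{-α}` (`normBlowup_of_pumpCascade`, the "blow-up of a
  stated norm" of the blueprint brief), now unconditional given the cascade.

(The interface field `CascadeWitness.memH10df` is automatic on the summit side:
`PumpContinuationSchwartzData.memH10df_schwartzL2`.) This file imports no route (`Theses/`) file
other than, transitively, the OPEN route `PumpContinuation` through
`PumpContinuationMildBlowupClassical`.
-/

set_option linter.dupNamespace false

noncomputable section

open Set
open scoped SchwartzMap

namespace Summit.NavierStokesRegularity.NavierStokesRegularity.Theorems.FluidComputer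

open Literature.Analysis.FluidPDE Literature.Analysis.FluidPDE.Tao2016
open Literature.Analysis.FluidPDE.FluidComputer
open Literature.Analysis.FunctionSpaces (eFourierSobolevNorm)

/-- **Discharge of `FluidComputer.H10MildTheory`**: local existence, uniqueness and the `H¹⁰`
continuation criterion for `H¹⁰_df`-mild solutions of the true Navier–Stokes equation, from the
in-tree `H¹⁰_df` theory of an arbitrary averaging datum specialised to `AveragingDatum.euler`. -/
theorem h10MildTheory_holds : H10MildTheory := by
  refine ⟨?_, ?_, ?_⟩
  · intro a ha
    have h := PerpetualPumpThesis.stub_thesis_LocalExistenceH10 AveragingDatum.euler a ha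
    rwa [Literature.Barriers.NavierStokesRegularity.AveragedTypeI.euler_form_eq] at h
  · intro a T u v hu hv
    rw [← Literature.Barriers.NavierStokesRegularity.AveragedTypeI.euler_form_eq] at hu hv
    exact PerpetualPumpThesis.stub_uniqueness AveragingDatum.euler a T u v hu hv
  · intro a T hT u hu C hC
    rw [← Literature.Barriers.NavierStokesRegularity.AveragedTypeI.euler_form_eq] at hu
    have h := PerpetualPumpThesis.Floor.extends_of_H10_bounded AveragingDatum.euler hT hu hC
    rwa [Literature.Barriers.NavierStokesRegularity.AveragedTypeI.euler_form_eq] at h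

/-- **Discharge of `FluidComputer.MildMaximalGivesBlowup`** (verbatim `MildBlowupClassical`,
proved in `PumpContinuationMildBlowupClassical.lean`). -/
theorem mildMaximalGivesBlowup_holds : MildMaximalGivesBlowup :=
  pumpContinuation_mildBlowupClassical_proof

/-- **X5a from a cascade witness**: a cascade witness for the true Navier–Stokes equations yields a
finite-energy classical (Leray–Hopf) solution from a rapidly decaying datum with finite maximal time
of smooth existence. Unconditional given the witness; nobody has one. -/
theorem x5a_of_cascadeWitness' (W : CascadeWitness) :
    ∃ ν : ℝ, 0 < ν ∧ ∃ T : ℝ, 0 < T ∧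
      ∃ (u : ℝ → EuclideanSpace ℝ (Fin 3) → EuclideanSpace ℝ (Fin 3))
        (p : ℝ → EuclideanSpace ℝ (Fin 3) → ℝ),
        IsMaximalSmoothSolution ν 0 u p T ∧ IsLerayHopfOn T ν 0 (u 0) u ∧ HasRapidSpatialDecay (u 0) :=
  x5a_of_cascadeWitness h10MildTheory_holds mildMaximalGivesBlowup_holds W

/-- **A cascade witness for the true Navier–Stokes equations refutes Clay (A)**
(`Literature.NS.blowup_assembly` applied to X5a and the in-tree Clay-class uniqueness
`blowup_clay_uniqueness`). HONEST FRAMING: an implication from an uninhabited-as-far-as-known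
structure; NOT a claim that NS blows up. -/
theorem ns_blowup_of_cascadeWitness (W : CascadeWitness) : ¬ NavierStokesRegularity :=
  Literature.NS.blowup_assembly ⟨x5a_of_cascadeWitness' W, blowup_clay_uniqueness⟩

/-- **A pump cascade for the true Navier–Stokes equations refutes Clay (A)** (`α > 0`: summable
firing times; `η > 1/4`: diverging `H¹` floors). HONEST FRAMING: the spec regime in which such a
cascade is even physically conceivable is `α ≥ 2`, i.e. `η ≥ 1/2` under the dimensional closure
(`CascadeSpecs.two_le_alphaEff_iff`), and no gadget meeting any of it is known. -/
theorem ns_blowup_of_pumpCascade {S : CascadeSpecs} (L : PumpCascade S) (hα : 0 < S.alpha)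
    (hη : 1 / 4 < S.eta) : ¬ NavierStokesRegularity :=
  ns_blowup_of_cascadeWitness (L.toCascadeWitness hα hη)

/-- **`H¹⁰`-norm blow-up from a pump cascade** (the "blow-up of a stated norm" of the blueprint):
the ignition datum's maximal `H¹⁰_df`-mild Navier–Stokes solution lives on some `[0, S_m)` with
`S_m ≤ T_* = ∑ C λ_n^{-α}` and has unbounded `H¹⁰` norm there. Unconditional given the cascade. -/
theorem normBlowup_of_pumpCascade {S : CascadeSpecs} (L : PumpCascade S) (hα : 0 < S.alpha)
    (hη : 1 / 4 < S.eta) :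
    ∃ Sm : ℝ, 0 < Sm ∧ Sm ≤ S.Tstar ∧ ∃ U : ℝ → L2C,
      IsMildSolutionFor eulerForm (schwartzL2 L.u₀) (Ico 0 Sm) U ∧
      ∀ C : ℝ, ∃ t ∈ Ico 0 Sm, ENNReal.ofReal C < eFourierSobolevNorm 10 (U t) :=
  L.normBlowup h10MildTheory_holds hα hη

end Summit.NavierStokesRegularity.NavierStokesRegularity.Theorems.FluidComputer

end
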